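import Mathlib
import Summits.ValiantsHypothesis.ValiantsHypothesis.Theorems.ValuativeGCTValuativeFlipCyclicTridiagonalContinuant

/-!
# Cofactors of a cyclic tridiagonal matrix, unrolled form (crux `ValuativeGCT.ValuativeFlip`,
# stub `stub_fourRowPencilRank`, part P1 of the cyclic-tridiagonal architecture)

Helper file (`--supports stmt-ValiantsHypothesis-12624`).  Deleting row `i` and column `j ≠ i` from
the cyclic tridiagonal matrix `A_rr = l_r, A_{r,r+1} = m_r, A_{r,r-1} = m'_r` (indices mod `n = N+1`)
and enumerating the kept rows as `i+1, i+2, …` and the kept columns as `j+1, j+2, …` gives the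
`N × N` matrix `ctU L M M' N d` below (`L x = l_{i+1+x}` etc., `d = (i - j) mod n ∈ [1, N]`), whose
entries only depend on `(y - x - d) mod n ∈ {0, 1, -1}`.  This file computes its permanent:

  `per (ctU L M M' N d) = (∏_{a<d} M (N-d+a)) · K_{N-d}(L, M, M')
                           + (∏_{x ≤ N-d} M' x) · K_{d-1}(data shifted by N-d+1)`

(`ct_permanent_ctU`) — the clockwise string times the continuant of the complementary arc plus the
counter-clockwise string times the continuant of its complementary arc
(`Cruxes/ValuativeFlip/AxisK9G1a2CyclicTridiagonal.md` §2, `f_ij = T_ij + S_ij`).  Proof: Laplace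
expansion along the row of `j` (two entries `m_j`, `m'_j`); the `m_j`-minor is block triangular
(path block × lower triangular string block); the `m'_j`-minor is expanded along the column of `i`
(entries `m'_{i+1}` and `m_{i-1}`): the `m_{i-1}`-term dies by Frobenius–König and the
`m'_{i+1}`-term is block diagonal (upper triangular string block × path block).
-/

set_option linter.dupNamespace false

namespace Summit.ValiantsHypothesis.ValiantsHypothesis.Theorems.ValuativeFlip

open scoped BigOperators Matrix
open Finset

variable {R : Type*} [CommRing R]

/-- The **unrolled cofactor matrix** of the cyclic tridiagonal matrix: rows `x` = kept rows
`i+1+x`, columns `y` = kept columns `j+1+y`, `d = (i-j) mod (N+1)`; entry `L x` / `M x` / `M' x`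
when `y ≡ x + d` / `x + d + 1` / `x + d - 1 (mod N+1)`, else `0`. [this crux] -/
def ctU (L M M' : ℕ → R) (N d : ℕ) : Matrix (Fin N) (Fin N) R := fun x y =>
  if (y : ℕ) = x + d ∨ (y : ℕ) + (N + 1) = x + d then L x
  else if (y : ℕ) = x + d + 1 ∨ (y : ℕ) + (N + 1) = x + d + 1 then M x
  else if (y : ℕ) + 1 = x + d ∨ (y : ℕ) + (N + 1) + 1 = x + d then M' x else 0

section Entries

variable (L M M' : ℕ → R) (N d : ℕ)

/-- Loop entries of `ctU`. [this crux] -/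
theorem ctU_apply_L {x y : Fin N} (h : (y : ℕ) = x + d ∨ (y : ℕ) + (N + 1) = x + d) :
    ctU L M M' N d x y = L x := by
  simp only [ctU]
  rw [if_pos h]

/-- Clockwise entries of `ctU`. [this crux] -/
theorem ctU_apply_M {x y : Fin N} (h₁ : ¬((y : ℕ) = x + d ∨ (y : ℕ) + (N + 1) = x + d))
    (h₂ : (y : ℕ) = x + d + 1 ∨ (y : ℕ) + (N + 1) = x + d + 1) : ctU L M M' N d x y = M x := by
  simp only [ctU]
  rw [if_neg h₁, if_pos h₂]

/-- Counter-clockwise entries of `ctU`. [this crux] -/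
theorem ctU_apply_M' {x y : Fin N} (h₁ : ¬((y : ℕ) = x + d ∨ (y : ℕ) + (N + 1) = x + d))
    (h₂ : ¬((y : ℕ) = x + d + 1 ∨ (y : ℕ) + (N + 1) = x + d + 1))
    (h₃ : (y : ℕ) + 1 = x + d ∨ (y : ℕ) + (N + 1) + 1 = x + d) : ctU L M M' N d x y = M' x := by
  simp only [ctU]
  rw [if_neg h₁, if_neg h₂, if_pos h₃]

/-- Zero entries of `ctU`. [this crux] -/
theorem ctU_apply_zero {x y : Fin N} (h₁ : ¬((y : ℕ) = x + d ∨ (y : ℕ) + (N + 1) = x + d))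
    (h₂ : ¬((y : ℕ) = x + d + 1 ∨ (y : ℕ) + (N + 1) = x + d + 1))
    (h₃ : ¬((y : ℕ) + 1 = x + d ∨ (y : ℕ) + (N + 1) + 1 = x + d)) : ctU L M M' N d x y = 0 := by
  simp only [ctU]
  rw [if_neg h₁, if_neg h₂, if_neg h₃]

end Entries

section Term1

variable (L M M' : ℕ → R)

/-- Values of `succAbove` as naturals (below the pivot). [folklore] -/
theorem ct_val_succAbove_of_lt {n : ℕ} (p : Fin (n + 1)) (r : Fin n) (h : (r : ℕ) < p) :
    (p.succAbove r : ℕ) = r := by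
  rw [Fin.succAbove_of_castSucc_lt _ _ (Fin.lt_def.mpr (by simpa using h)), Fin.val_castSucc]

/-- Values of `succAbove` as naturals (at or above the pivot). [folklore] -/
theorem ct_val_succAbove_of_le {n : ℕ} (p : Fin (n + 1)) (r : Fin n) (h : (p : ℕ) ≤ r) :
    (p.succAbove r : ℕ) = r + 1 := by
  rw [Fin.succAbove_of_le_castSucc _ _ (Fin.le_def.mpr (by simpa using h)), Fin.val_succ]

/-- The column re-enumeration used for the `m_j`-minor: first the path columns `d, …, k+1`, then the
string columns `1, …, d-1`. [this crux] -/
def ctC₁ (k d : ℕ) (hd : d ≤ k + 2) (y : Fin (k + 1)) : Fin (k + 2) :=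
  if h : (y : ℕ) < k + 2 - d then ⟨y + d, by omega⟩ else ⟨y - (k + 2 - d) + 1, by omega⟩

/-- `ctC₁` enumerates exactly the nonzero columns. [this crux] -/
theorem ct_range_ctC₁ (k d : ℕ) (hd₁ : 1 ≤ d) (hd : d ≤ k + 2) :
    Set.range (ctC₁ k d hd) = Set.range (Fin.succ : Fin (k + 1) → Fin (k + 2)) := by
  ext y
  simp only [Set.mem_range]
  constructor
  · rintro ⟨y', rfl⟩
    have hne : ctC₁ k d hd y' ≠ 0 := by
      intro h0
      have := congrArg Fin.val h0
      unfold ctC₁ at this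
      split_ifs at this with h
      · simp at this
        omega
      · simp at this
    exact ⟨(ctC₁ k d hd y').pred hne, Fin.succ_pred _ _⟩
  · rintro ⟨y', rfl⟩
    by_cases h : d ≤ (y' : ℕ) + 1
    · refine ⟨⟨(y' : ℕ) + 1 - d, by omega⟩, Fin.ext ?_⟩
      unfold ctC₁
      rw [dif_pos (by dsimp only; omega)]
      simp only [Fin.val_succ]
      omega
    · refine ⟨⟨(y' : ℕ) + (k + 2 - d), by omega⟩, Fin.ext ?_⟩
      unfold ctC₁
      rw [dif_neg (by dsimp only; omega)]
      simp only [Fin.val_succ]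
      omega

/-- `ctC₁` is injective. [this crux] -/
theorem ct_injective_ctC₁ (k d : ℕ) (hd : d ≤ k + 2) :
    Function.Injective (ctC₁ k d hd) := by
  intro a b hab
  have h := congrArg Fin.val hab
  unfold ctC₁ at h
  apply Fin.ext
  split_ifs at h with h1 h2 h2 <;> simp at h <;> omega

/-- **The `m_j`-minor** (delete the row of `j` and the column of `j+1` from the unrolled matrix):
block triangular after the column re-enumeration `ctC₁`, with the path block `K_{k+2-d}` and a
lower triangular string block with diagonal `M (k+3-d), …, M (k+1)`. [this crux] -/
theorem ct_permanent_term1 (k d : ℕ) (hd₁ : 1 ≤ d) (hd : d ≤ k + 2) (r₀ : Fin (k + 2))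
    (hr₀ : (r₀ : ℕ) = k + 2 - d) :
    ((ctU L M M' (k + 2) d).submatrix r₀.succAbove Fin.succ).permanent =
      ctK L M M' (k + 2 - d) * ∏ a ∈ Finset.range (d - 1), M (k + 3 - d + a) := by
  -- re-enumerate the columns
  rw [ct_permanent_submatrix_eq_of_range_eq _ r₀.succAbove r₀.succAbove Fin.succ (ctC₁ k d hd)
    Fin.succAbove_right_injective Fin.succAbove_right_injective rfl (Fin.succ_injective _)
    (ct_injective_ctC₁ k d hd) (ct_range_ctC₁ k d hd₁ hd).symm]
  set V := (ctU L M M' (k + 2) d).submatrix r₀.succAbove (ctC₁ k d hd) with hV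
  have hp : k + 2 - d ≤ k + 1 := by omega
  have hC₁lt : ∀ c : Fin (k + 1), (c : ℕ) < k + 2 - d → (ctC₁ k d hd c : ℕ) = c + d := by
    intro c hc
    unfold ctC₁
    rw [dif_pos hc]
  have hC₁ge : ∀ c : Fin (k + 1), k + 2 - d ≤ (c : ℕ) → (ctC₁ k d hd c : ℕ) = c - (k + 2 - d) + 1 := by
    intro c hc
    unfold ctC₁
    rw [dif_neg (by omega)]
  rw [hb_permanent_split V (k + 2 - d) hp (fun r c hc hr => by
    rw [hV, Matrix.submatrix_apply]
    have h1 := ct_val_succAbove_of_le r₀ r (by omega)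
    have h2 := hC₁lt c hc
    have hr' : (r : ℕ) < k + 1 := r.isLt
    exact ctU_apply_zero L M M' (k + 2) d (by omega) (by omega) (by omega))]
  -- the path block
  have htop : V.submatrix (Fin.castLE hp) (Fin.castLE hp) = ctPath L M M' (k + 2 - d) := by
    ext a b
    simp only [hV, Matrix.submatrix_apply, ctPath_apply]
    have ha := ct_val_succAbove_of_lt r₀ (Fin.castLE hp a) (by simp; omega)
    have hb := hC₁lt (Fin.castLE hp b) (by simp)
    simp only [Fin.val_castLE] at ha hb
    by_cases e1 : (b : ℕ) = a
    · rw [if_pos e1, ctU_apply_L L M M' (k + 2) d (by omega), ha]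
    rw [if_neg e1]
    by_cases e2 : (b : ℕ) = a + 1
    · rw [if_pos e2, ctU_apply_M L M M' (k + 2) d (by omega) (by omega), ha]
    rw [if_neg e2]
    by_cases e3 : (a : ℕ) = b + 1
    · rw [if_pos e3, ctU_apply_M' L M M' (k + 2) d (by omega) (by omega) (by omega), ha]
    rw [if_neg e3, ctU_apply_zero L M M' (k + 2) d (by omega) (by omega) (by omega)]
  -- the lower triangular string block
  have hbot : (V.submatrix (fun x : Fin (k + 1 - (k + 2 - d)) => (⟨k + 2 - d + x, by omega⟩ : Fin (k + 1)))
      (fun x : Fin (k + 1 - (k + 2 - d)) => (⟨k + 2 - d + x, by omega⟩ : Fin (k + 1)))).permanent =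
      ∏ a ∈ Finset.range (d - 1), M (k + 3 - d + a) := by
    rw [ct_permanent_of_lowerTriangular]
    · rw [show d - 1 = k + 1 - (k + 2 - d) by omega, ← Fin.prod_univ_eq_prod_range]
      refine Finset.prod_congr rfl fun a _ => ?_
      simp only [Matrix.submatrix_apply, hV]
      have ha := ct_val_succAbove_of_le r₀ ⟨k + 2 - d + a, by omega⟩ (by simp; omega)
      have hb := hC₁ge ⟨k + 2 - d + a, by omega⟩ (by simp)
      simp only at ha hb
      rw [ctU_apply_M L M M' (k + 2) d (by omega) (by omega), ha]
      congr 1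
      omega
    · intro a b hab
      simp only [Matrix.submatrix_apply, hV]
      have ha := ct_val_succAbove_of_le r₀ ⟨k + 2 - d + a, by omega⟩ (by simp; omega)
      have hb := hC₁ge ⟨k + 2 - d + b, by omega⟩ (by simp)
      simp only at ha hb
      have hab' : (a : ℕ) < b := hab
      exact ctU_apply_zero L M M' (k + 2) d (by omega) (by omega) (by omega)
  rw [htop, hbot, ct_permanent_ctPath]

end Term1

section Term2

variable (L M M' : ℕ → R)

/-- **The `m'_j`-minor in the extreme case `d = N`** (`j = i + 1`): deleting the row of `j` (the
first kept row) and the column of `j - 1 = i` (the last kept column) leaves the path matrix of the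
arc `i+2, …, i-1`, i.e. the data shifted by one. [this crux] -/
theorem ct_permanent_term2_top (k : ℕ) :
    ((ctU L M M' (k + 2) (k + 2)).submatrix (0 : Fin (k + 2)).succAbove Fin.castSucc).permanent =
      ctK (fun t => L (1 + t)) (fun t => M (1 + t)) (fun t => M' (1 + t)) (k + 1) := by
  rw [← ct_permanent_ctPath]
  congr 1
  ext a b
  simp only [Matrix.submatrix_apply, Fin.succAbove_zero, ctPath_apply]
  have ha : (a : ℕ) < k + 1 := a.isLt
  have hb : (b : ℕ) < k + 1 := b.isLt
  have hsa : ((a.succ : Fin (k + 2)) : ℕ) = a + 1 := by simp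
  have hcb : ((Fin.castSucc b : Fin (k + 2)) : ℕ) = b := by simp
  by_cases e1 : (b : ℕ) = a
  · rw [if_pos e1, ctU_apply_L L M M' (k + 2) (k + 2) (by omega), hsa, Nat.add_comm]
  rw [if_neg e1]
  by_cases e2 : (b : ℕ) = a + 1
  · rw [if_pos e2, ctU_apply_M L M M' (k + 2) (k + 2) (by omega) (by omega), hsa, Nat.add_comm]
  rw [if_neg e2]
  by_cases e3 : (a : ℕ) = b + 1
  · rw [if_pos e3, ctU_apply_M' L M M' (k + 2) (k + 2) (by omega) (by omega) (by omega), hsa,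
      Nat.add_comm]
  rw [if_neg e3, ctU_apply_zero L M M' (k + 2) (k + 2) (by omega) (by omega) (by omega)]

/-- The column re-enumeration used for the `m'_{i+1}`-minor of the `m'_j`-minor: first the string
columns `d, …, k`, then the path columns `0, …, d-2`. [this crux] -/
def ctC₂ (k d : ℕ) (hd : d ≤ k + 1) (y : Fin k) : Fin (k + 1) :=
  if h : (y : ℕ) < k + 1 - d then ⟨y + d, by omega⟩ else ⟨y - (k + 1 - d), by omega⟩

/-- `ctC₂` enumerates exactly the columns `≠ d - 1`. [this crux] -/
theorem ct_range_ctC₂ (k d : ℕ) (hd₁ : 1 ≤ d) (hd : d ≤ k + 1) :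
    Set.range (ctC₂ k d hd) = Set.range (Fin.succAbove (⟨d - 1, by omega⟩ : Fin (k + 1))) := by
  rw [Fin.range_succAbove]
  ext y
  simp only [Set.mem_range, Set.mem_compl_iff, Set.mem_singleton_iff]
  constructor
  · rintro ⟨y', rfl⟩ h
    have := congrArg Fin.val h
    unfold ctC₂ at this
    split_ifs at this with h1 <;> simp at this <;> omega
  · intro hy
    have hy' : (y : ℕ) ≠ d - 1 := fun h => hy (Fin.ext (by simpa using h))
    have hyk : (y : ℕ) < k + 1 := y.isLt
    by_cases h : d ≤ (y : ℕ)
    · refine ⟨⟨(y : ℕ) - d, by omega⟩, Fin.ext ?_⟩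
      unfold ctC₂
      rw [dif_pos (by dsimp only; omega)]
      dsimp only
      omega
    · refine ⟨⟨(y : ℕ) + (k + 1 - d), by omega⟩, Fin.ext ?_⟩
      unfold ctC₂
      rw [dif_neg (by dsimp only; omega)]
      dsimp only
      omega

/-- `ctC₂` is injective. [this crux] -/
theorem ct_injective_ctC₂ (k d : ℕ) (hd : d ≤ k + 1) : Function.Injective (ctC₂ k d hd) := by
  intro a b hab
  have h := congrArg Fin.val hab
  unfold ctC₂ at h
  apply Fin.ext
  split_ifs at h with h1 h2 h2 <;> simp at h <;> omega

/-- **The `m'_{i+1}`-minor of the `m'_j`-minor** (`d ≤ N - 1`): rows `i+2, …, i-1` except `j`,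
columns `j+1, …, j-2` except `i`; block diagonal after the column re-enumeration `ctC₂`: an upper
triangular string block with diagonal `M' 1, …, M' (k+1-d)` and the path block of the arc
`j+1, …, i-1` (data shifted by `k+3-d`). [this crux] -/
theorem ct_permanent_term2_inner (k d : ℕ) (hd₁ : 1 ≤ d) (hd : d ≤ k + 1) (r₀ : Fin (k + 2))
    (hr₀ : (r₀ : ℕ) = k + 2 - d) :
    ((((ctU L M M' (k + 2) d).submatrix r₀.succAbove Fin.castSucc).submatrix Fin.succ
      (Fin.succAbove (⟨d - 1, by omega⟩ : Fin (k + 1)))).permanent) =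
      (∏ a ∈ Finset.range (k + 1 - d), M' (a + 1)) *
        ctK (fun t => L (k + 3 - d + t)) (fun t => M (k + 3 - d + t)) (fun t => M' (k + 3 - d + t))
          (d - 1) := by
  rw [ct_permanent_submatrix_eq_of_range_eq _ Fin.succ Fin.succ _ (ctC₂ k d hd) (Fin.succ_injective _)
    (Fin.succ_injective _) rfl Fin.succAbove_right_injective (ct_injective_ctC₂ k d hd)
    (ct_range_ctC₂ k d hd₁ hd).symm]
  set W := ((ctU L M M' (k + 2) d).submatrix r₀.succAbove Fin.castSucc).submatrix Fin.succ (ctC₂ k d hd)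
    with hW
  have hp : k + 1 - d ≤ k := by omega
  have hC₂lt : ∀ c : Fin k, (c : ℕ) < k + 1 - d → (ctC₂ k d hd c : ℕ) = c + d := by
    intro c hc
    unfold ctC₂
    rw [dif_pos hc]
  have hC₂ge : ∀ c : Fin k, k + 1 - d ≤ (c : ℕ) → (ctC₂ k d hd c : ℕ) = c - (k + 1 - d) := by
    intro c hc
    unfold ctC₂
    rw [dif_neg (by omega)]
  -- entries of `W`: row `a` is row `a + 1` (if `a + 1 < r₀`) or `a + 2` of `ctU`
  have hWapply : ∀ a b : Fin k, W a b = ctU L M M' (k + 2) d (r₀.succAbove a.succ) (Fin.castSucc (ctC₂ k d hd b)) := by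
    intro a b
    rfl
  rw [hb_permanent_split W (k + 1 - d) hp (fun r c hc hr => by
    rw [hWapply]
    have h1 := ct_val_succAbove_of_le r₀ r.succ (by simp; omega)
    have h2 := hC₂lt c hc
    have hr' : (r : ℕ) < k := r.isLt
    simp only [Fin.val_succ] at h1
    exact ctU_apply_zero L M M' (k + 2) d (by simp only [Fin.val_castSucc]; omega)
      (by simp only [Fin.val_castSucc]; omega) (by simp only [Fin.val_castSucc]; omega))]
  -- the upper triangular string block
  have htop : (W.submatrix (Fin.castLE hp) (Fin.castLE hp)).permanent =
      ∏ a ∈ Finset.range (k + 1 - d), M' (a + 1) := by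
    rw [hb_permanent_of_upperTriangular]
    · rw [← Fin.prod_univ_eq_prod_range]
      refine Finset.prod_congr rfl fun a _ => ?_
      simp only [Matrix.submatrix_apply, hWapply]
      have ha := ct_val_succAbove_of_lt r₀ (Fin.castLE hp a).succ (by simp; omega)
      have hb := hC₂lt (Fin.castLE hp a) (by simp)
      simp only [Fin.val_succ, Fin.val_castLE] at ha hb
      rw [ctU_apply_M' L M M' (k + 2) d (by simp only [Fin.val_castSucc]; omega)
        (by simp only [Fin.val_castSucc]; omega) (by simp only [Fin.val_castSucc]; omega), ha]
    · intro a b hab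
      simp only [Matrix.submatrix_apply, hWapply]
      have ha := ct_val_succAbove_of_lt r₀ (Fin.castLE hp a).succ (by simp; omega)
      have hb := hC₂lt (Fin.castLE hp b) (by simp)
      simp only [Fin.val_succ, Fin.val_castLE] at ha hb
      have hab' : (b : ℕ) < a := hab
      exact ctU_apply_zero L M M' (k + 2) d (by simp only [Fin.val_castSucc]; omega)
        (by simp only [Fin.val_castSucc]; omega) (by simp only [Fin.val_castSucc]; omega)
  -- the path block
  have hbot : W.submatrix (fun x : Fin (k - (k + 1 - d)) => (⟨k + 1 - d + x, by omega⟩ : Fin k))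
      (fun x : Fin (k - (k + 1 - d)) => (⟨k + 1 - d + x, by omega⟩ : Fin k)) =
      ctPath (fun t => L (k + 3 - d + t)) (fun t => M (k + 3 - d + t)) (fun t => M' (k + 3 - d + t))
        (k - (k + 1 - d)) := by
    ext a b
    simp only [Matrix.submatrix_apply, hWapply, ctPath_apply]
    have ha := ct_val_succAbove_of_le r₀ (Fin.succ ⟨k + 1 - d + a, by omega⟩) (by simp; omega)
    have hb := hC₂ge ⟨k + 1 - d + b, by omega⟩ (by simp)
    simp only [Fin.val_succ] at ha hb
    have hx : k + 3 - d + (a : ℕ) = k + 1 - d + a + 1 + 1 := by omega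
    by_cases e1 : (b : ℕ) = a
    · rw [if_pos e1, ctU_apply_L L M M' (k + 2) d (by simp only [Fin.val_castSucc]; omega), ha, hx]
    rw [if_neg e1]
    by_cases e2 : (b : ℕ) = a + 1
    · rw [if_pos e2, ctU_apply_M L M M' (k + 2) d (by simp only [Fin.val_castSucc]; omega)
        (by simp only [Fin.val_castSucc]; omega), ha, hx]
    rw [if_neg e2]
    by_cases e3 : (a : ℕ) = b + 1
    · rw [if_pos e3, ctU_apply_M' L M M' (k + 2) d (by simp only [Fin.val_castSucc]; omega)
        (by simp only [Fin.val_castSucc]; omega) (by simp only [Fin.val_castSucc]; omega), ha, hx]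
    rw [if_neg e3, ctU_apply_zero L M M' (k + 2) d (by simp only [Fin.val_castSucc]; omega)
      (by simp only [Fin.val_castSucc]; omega) (by simp only [Fin.val_castSucc]; omega)]
  rw [htop, hbot, ct_permanent_ctPath, show k - (k + 1 - d) = d - 1 by omega]

end Term2

end Summit.ValiantsHypothesis.ValiantsHypothesis.Theorems.ValuativeFlip
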